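import Literature.Computability.Learning.IWPadGeneratorCaseB
import Literature.Computability.Complexity.TVHardness
import HarnessLib

/-!
# `impagliazzoWigderson1998` (van Melkebeek Thm. 6.2.1 = IW98 Thm. 5): fact split into the uniform
# reconstruction theorem for Trevisan–Vadhan's language (D-0027 A7 exception, batch libsplit-26)

Split file for the XL named fact `Literature.Computability.Complexity.impagliazzoWigderson1998`
(`Complexity/UniformDerandomizationRandAlg.lean`: if `BPP ≠ EXP` then every `BPP` language has, for
every `ε > 0`, a `DTIME(2^{n^ε})` simulation correct with probability `> 1 − m^{−d}` against every
polynomial-time sampler, infinitely often). The tree has PROVED the whole printed architecture of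
Impagliazzo–Wigderson 1998, §2 / Trevisan–Vadhan 2007, §3–4, except one theorem:

* Case 1 (`EXP ⊄ P/poly`, Babai–Fortnow–Nisan–Wigderson 1993) — PROVED
  (`Complexity/BFNWCase1.lean`: `BPP_subset_io_DTIME_of_not_EXP_subset_PPoly`);
* the case split, the majority-vote simulation, the distinguisher-to-test-sampler step (IW Lemma 13)
  and the endgame of Case 2 (`EXP ⊆ P/poly`, `BPP ≠ EXP` ⟹ no `PSPACE`-hard language in `BPP`,
  Meyer + `PH ⊆ PSPACE`) — PROVED (`UniformDerandomization{RandAlgProofs,Assembly,Proofs,Endgame}`,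
  `Learning/IWPadGenerator{,Value,Fools,CaseB}`);
* the `PSPACE`-complete, downward-self-reducible, self-correctible language `LTV` of Trevisan–Vadhan
  Thm. 4.3 — CONSTRUCTED AND PROVED (`Complexity/TVFunction.lean`, `TVHardness.lean`:
  `TVHard.isHard_PSPACE_LTV`; `TVDsrMachine.lean`: `TVChk.dsrAlg_run`; `TVSelfCorrect*.lean`);
* the bootstrapping of IW Lemma 16 (`IWBootstrapping.lean`), the weak-to-strong selection by testing
  of IW Lemma 18 (`UniformDerandomizationSelect*.lean`) and the random-self-reduction bridge of IW
  Def. 5 (`UniformDerandomizationRSRBridge.lean`) — PROVED building blocks, not yet assembled;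

so that the fact follows (`IWGen.impagliazzoWigderson1998_of_reconstruction`,
`Learning/IWPadGeneratorCaseB.lean`) from the existence of a `PSPACE`-hard `L_f` and an
`H ∈ DTIME(2^{n^b})` with the UNIFORM RECONSTRUCTION PROPERTY: a probabilistic polynomial-time test
telling the pad generator `iwGen k e c₀` (= the Nisan–Wigderson generator on the slices of `H`)
from uniform at almost all lengths puts `L_f` in `BPP`. This file makes that property a NOTION and
names the remaining theorem as the single CHILD of the split (notion + consequence), specialised to
the tree's proved hard language `L_f = LTV`:

* `IWGen.IsUniformlyReconstructible Lf H b` (notion) — verbatim the reconstruction hypothesis of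
  `hingeB_of_reconstruction` / `impagliazzoWigderson1998_of_reconstruction`;
* `IWGen.TrevisanVadhan2007_uniformReconstruction_LTV` (child fact) — there are `H ∈ DTIME(2^{n^b})`
  (in print: the hardness-amplified encoding `f̂` of `F = FB`, IW §2.3–2.4 / TV Lemma 3.3 with
  Sudan–Trevisan–Vadhan decoding) with `IsUniformlyReconstructible LTV H b` — IW98 Lemmas 14–17
  (NW reconstruction with the downward self-reduction answering the oracle queries, learning of
  approximate circuits, random self-correction, bootstrapping over the lengths) = TV07 proof of
  Thm. 3.9 with Thm. 4.3 and Lemmas 3.4–3.6;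
* `impagliazzoWigderson1998_holds_of` — the parent from the child (PROVED), and the same for the
  tree's equivalent rendering `impagliazzoWigderson1998_samplable`.

The child is the "main technical theorem" of the two papers and is neither a restatement nor a
special case of the parent (it speaks of one explicit language and of generators, not of `BPP`).
A prover discharging it should assemble the proved blocks listed above: distinguisher at length `ℓ`
⟹ (NW hybrid + TV Lemma 3.3 list-decoding, the MISSING piece) a weak construction of approximate
circuits for `LTV ∩ {0,1}^{n(ℓ)}` using `LTV` as oracle ⟹ `reducibleUsing_of_weakStage` ⟹
`stronglyConstructible_circuitsFor_of_ttFnL` ⟹ `IWUniform.mem_BPP_of_dsr_of_stronglyConstructible`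
with `TVChk.dsrAlg_run`.

## References

* [ImpagliazzoWigderson2001] R. Impagliazzo, A. Wigderson, *Randomness vs time: derandomization under
  a uniform assumption*, JCSS 63 (2001) 672–688 (FOCS 1998): Thm. 5, §2.1–2.4, Lemmas 13–18.
* [TrevisanVadhan2007] L. Trevisan, S. Vadhan, *Pseudorandomness and average-case complexity via
  uniform reductions*, Comput. Complexity 16 (2007) 331–364: Lemmas 3.3–3.6, Thm. 3.9 (proof),
  Thm. 4.3.
* [VanMelkebeek2000] D. van Melkebeek, LNCS 1950 (2000), Thm. 6.2.1 (p. 142).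
-/

noncomputable section

open Polynomial Filter

namespace Literature.Computability.Learning

open Literature.Computability.Complexity Literature.Computability.Complexity.UDerand
  Literature.Computability.MetaComplexity _root_.Computability

namespace IWGen

/-- **The uniform reconstruction property of a pair `(L_f, H)` at exponent `b`** (notion; the
conclusion of Impagliazzo–Wigderson 1998, Lemmas 14–17 / Trevisan–Vadhan 2007, Lemmas 3.4–3.6 for a
downward-self-reducible, self-correctible `L_f` and its amplified encoding `H`, abstracted from the
pair). For all stretch and pad exponents `k`, `c₀ > b` and every machine code `e` such that the pad
generator `iwGen k e c₀ ℓ` IS, for all large `ℓ`, the Nisan–Wigderson generator of the slice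
`H ∩ {0,1}^ℓ` on the design `designOf k ℓ` (seed `zOf ℓ σ`, `q = prmQ ℓ`; this premise holds for the
code of any `DTIME(2^{n^b})` decider of `H`, `eventually_iwGen_eq_ofFn_nwGenerator`): whenever a
probabilistic polynomial-time test `T` with an exact polynomial coin budget distinguishes the
generator's output from uniform with advantage `≥ ℓ^{−c}` at ALL large `ℓ`
(`|seedAvg − unifAvg| ≥ ℓ^{−c}` eventually), the language `L_f` is in `BPP`. Verbatim the
hypothesis `hLearn` of `hingeB_of_reconstruction`.
[cite: ImpagliazzoWigderson2001, §2.2 Lemmas 14–17] [cite: TrevisanVadhan2007, Lemmas 3.4–3.6 and Thm. 3.9 (proof)] -/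
def IsUniformlyReconstructible (Lf H : Language Bool) (b : ℕ) : Prop :=
  ∀ (k c₀ : ℕ) (e : List Bool), b < c₀ →
    (∀ᶠ ℓ in atTop, ∀ (σ : List Bool) (hσ : prmQ ℓ * prmQ ℓ ≤ σ.length),
        iwGen k e c₀ ℓ σ = List.ofFn (nwGenerator (designOf k ℓ) (H.sliceFn ℓ) (zOf ℓ σ hσ))) →
    ∀ T : RandAlg (List Bool) Bool, T.IsPolyTime id encodeBool →
      (∃ q : Polynomial ℕ, ∀ N, T.coinLen N = q.eval N) → ∀ c : ℕ,
        (∀ᶠ ℓ : ℕ in atTop, 1 / (ℓ : ℝ) ^ c ≤ |seedAvg c₀ k (iwGen k e c₀) T ℓ - unifAvg k T ℓ|) →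
          Lf ∈ BPP

/-- **Trevisan–Vadhan 2007, Thm. 3.9 (proof) with Thm. 4.3 / Impagliazzo–Wigderson 1998, Lemmas
14–17, for the language `LTV`** — CHILD fact of the split of `impagliazzoWigderson1998`. For
Trevisan–Vadhan's `PSPACE`-complete, downward-self-reducible and self-correctible language
`LTV = {w | FB w = 1}` (`Complexity/TVFunction.lean`; TV Thm. 4.3, IW Def. 5–6) there are an
exponent `b` and a language `H ∈ DTIME(2^{n^b})` — in print the hardness-amplified truth-table
encoding of `FB` (IW §2.3 "`f̂`", TV Lemma 3.3: a code with uniform local list-decoding) — such that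
the pair `(LTV, H)` has the uniform reconstruction property `IsUniformlyReconstructible LTV H b`:
if the Nisan–Wigderson generator on the slices of `H` is told from uniform by a uniform
probabilistic polynomial-time test with inverse-polynomial advantage at all large lengths, then
`LTV ∈ BPP` ("if the generator built from `f` is distinguishable for almost all input lengths by a
uniform test, then `f ∈ BPP`": learn approximate circuits from the distinguisher, answer the NW
reconstruction's oracle queries by the downward self-reduction from shorter lengths, self-correct,
and bootstrap over all lengths).
[cite: TrevisanVadhan2007, Thm. 3.9 (proof), Thm. 4.3 and Lemmas 3.3–3.6]
[cite: ImpagliazzoWigderson2001, §2.2–2.4, Lemmas 14–17] -/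
def TrevisanVadhan2007_uniformReconstruction_LTV : Prop :=
  ∃ (H : Language Bool) (b : ℕ), H ∈ DTIME (fun n => 2 ^ n ^ b) ∧
    IsUniformlyReconstructible QBFUniv.LTV H b

/-- **Assembly of the split (PROVED):** `impagliazzoWigderson1998` from its single child. The
child supplies `(LTV, H, b)`; `LTV` is `PSPACE`-hard (`TVHard.isHard_PSPACE_LTV`, TV Thm. 4.3,
proved); and `impagliazzoWigderson1998_of_reconstruction` (Case 1 = BFNW proved, Case 2 endgame
proved) concludes. [cite: VanMelkebeek2000, Thm. 6.2.1] [cite: ImpagliazzoWigderson2001, Thm. 5]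
[cite: TrevisanVadhan2007, Thm. 3.9] -/
theorem _root_.Literature.Computability.Complexity.impagliazzoWigderson1998_holds_of
    (h : TrevisanVadhan2007_uniformReconstruction_LTV) : impagliazzoWigderson1998 := by
  obtain ⟨H, b, hH, hrec⟩ := h
  exact impagliazzoWigderson1998_of_reconstruction ⟨QBFUniv.LTV, H, b, TVHard.isHard_PSPACE_LTV, hH, hrec⟩

/-- The same child discharges the tree's equivalent rendering `impagliazzoWigderson1998_samplable`
(`Complexity/UniformDerandomization.lean`, samplers `Ensemble.IsPolySamplable`).
[cite: VanMelkebeek2000, Thm. 6.2.1] -/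
theorem _root_.Literature.Computability.Complexity.impagliazzoWigderson1998_samplable_holds_of
    (h : TrevisanVadhan2007_uniformReconstruction_LTV) : impagliazzoWigderson1998_samplable := by
  obtain ⟨H, b, hH, hrec⟩ := h
  exact impagliazzoWigderson1998_samplable_of_reconstruction
    ⟨QBFUniv.LTV, H, b, TVHard.isHard_PSPACE_LTV, hH, hrec⟩

/-- For any pair, the notion is exactly what `hingeB_of_reconstruction` consumes: a `PSPACE`-hard
`L_f` with a uniformly reconstructible `H ∈ DTIME(2^{n^b})` gives the fact (the general form of the
assembly, for provers who prefer another hard language, e.g. IW's `ModPerm` under `EXP ⊆ P/poly`).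
[cite: ImpagliazzoWigderson2001, Thm. 5 and Lemma 11] -/
theorem impagliazzoWigderson1998_of_isUniformlyReconstructible {Lf H : Language Bool} {b : ℕ}
    (hHard : IsHard PSPACE Lf) (hH : H ∈ DTIME (fun n => 2 ^ n ^ b))
    (hrec : IsUniformlyReconstructible Lf H b) : impagliazzoWigderson1998 :=
  impagliazzoWigderson1998_of_reconstruction ⟨Lf, H, b, hHard, hH, hrec⟩

end IWGen

end Literature.Computability.Learning

end
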